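import Mathlib
import Summits.Ventures.Crystal3D.Theorems.StickyWulffConstantLayerChainDefs
import Summits.Ventures.Crystal3D.Theorems.StickyWulffConstantStackingLiminfCalibration
import Summits.Ventures.Crystal3D.Theorems.StickyWulffConstantStackingLiminfRungPairingIdentity
import HarnessLib

/-!
# S3-core of stub (B) `MollifiedUpper` (line LayerChain v4, crux `StackingLiminf`, stmt-Ventures-19145):
# the pointwise TWO-PHASE PAIRING BOUND for the homogenised stacking tension

Cell `crystal3d-full`, venture `Summits/Ventures/Crystal3D`.  BLUEPRINT-v4B step (S3), finite-dimensional
core, now in the kernel.  Fix a letter density `f ∈ [0,1]` and decompose a normal `n = Σ_{k ∈ S} m_k` into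
finitely many "layer" contributions `m_k` (in the application `m_k = −∇w_k(y)`, the gradient of the mollified
density of layer `k` at the point `y`), each layer carrying the letter `s k` of the gap ABOVE it (`s k = 1`:
up-bonds `bPlus i`; otherwise `bMinus i`), and attach to each layer a real `d_k` (in the application
`d_k = w_k(y) − w_{k+1}(y)`) with `Σ_k d_k = 0` (telescoping over a padded range of layers).  Then

`stackTension f n ≤ Σ_i |n · a_i| + Σ_{k ∈ S} Σ_i |m_k · b_{s k, i} + d_k| + Σ_i |e · bPlus_i − e · bMinus_i|`,

where `e := Σ_{k : s k ≠ 1} m_k − f · n` is the SKEW vector (the `−1`-phase part of the normal minus its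
expected share `f`).  Proof: strong duality `stackTension f n = calibFlux f n α βp βm` for a conserved
unit-capacity flow (`exists_stackTension_eq_calibFlux`, i.e. `stub_calibration`, p473564), then the
regrouping of R4: `(1−f) n·b⁺_i = n⁺·b⁺_i + e·b⁺_i`, `f n·b⁻_i = n⁻·b⁻_i − e·b⁻_i`; the phase sums pair
each layer with the field of ITS phase, the `d_k` cost nothing because `Σ βp = Σ βm` makes their total
`(Σβ)·Σ_k d_k = 0`, and the skew pairs only with `Σ_i (βp_i + βm_i) ℓ_i` because
`e·bPlus_i + e·bMinus_i = 2h·e₃` is the same for all `i` and `Σ βp = Σ βm` (Kirchhoff) kills it: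
the skew direction `bPlus_i − bMinus_i = (2ℓ_i, 0)` is HORIZONTAL, so in the application no derivative of
the height profile `f̄` ever appears.
WHAT THIS IS NOT: stub (B) (the integrated inequality needs S1 p512839, the Taylor step S2, the lateral
convolution calculus and the skew bound S4); rung F-C1 not moved.
-/

noncomputable section

namespace Summit.Ventures.Crystal3D.Theorems

open Finset
open Summit.Ventures.Crystal3D.LayerChain

/-- `dot3` is additive in its first argument. -/
theorem dot3_add_left (u v w : Fin 3 → ℝ) : dot3 (u + v) w = dot3 u w + dot3 v w := by
  unfold dot3; simp only [Pi.add_apply]; ring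

/-- `dot3` is homogeneous in its first argument. -/
theorem dot3_smul_left (c : ℝ) (u w : Fin 3 → ℝ) : dot3 (c • u) w = c * dot3 u w := by
  unfold dot3; simp only [Pi.smul_apply, smul_eq_mul]; ring

/-- `dot3` is subtractive in its first argument. -/
theorem dot3_sub_left (u v w : Fin 3 → ℝ) : dot3 (u - v) w = dot3 u w - dot3 v w := by
  unfold dot3; simp only [Pi.sub_apply]; ring

/-- The sum of the pairings of a vector with `bPlus i` and `bMinus i` does not depend on `i`:
it is `2h` times the vertical component (`bPlus i + bMinus i = (0, 0, 2h)`). -/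
theorem dot3_bPlus_add_dot3_bMinus (e : Fin 3 → ℝ) (i : Fin 3) :
    dot3 e (bPlus i) + dot3 e (bMinus i) = 2 * Real.sqrt (2 / 3) * e 2 := by
  fin_cases i <;> simp [dot3, bPlus, bMinus] <;> ring

/-- **S3-core: the two-phase pairing bound.**  For `f ∈ [0,1]`, a finite family of layer vectors `m k`
with letters `s k` and reals `d k` summing to zero, the homogenised stacking tension of `n = Σ m k` is at
most the in-plane terms `Σ_i |n·a_i|`, plus the per-layer gap terms `Σ_k Σ_i |m k · b_{s k,i} + d k|`, plus
the skew term `Σ_i |e·bPlus i − e·bMinus i|` with `e = Σ_{s k ≠ 1} m k − f·n`. -/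
theorem stackTension_le_pairing (f : ℝ) (hf0 : 0 ≤ f) (hf1 : f ≤ 1) {ι : Type*} (S : Finset ι)
    (s : ι → ℤ) (m : ι → Fin 3 → ℝ) (d : ι → ℝ) (hd : ∑ k ∈ S, d k = 0) :
    stackTension f (∑ k ∈ S, m k) ≤
      (∑ i : Fin 3, |dot3 (∑ k ∈ S, m k) (aVec i)|) +
      (∑ k ∈ S, ∑ i : Fin 3, |dot3 (m k) (if s k = 1 then bPlus i else bMinus i) + d k|) +
      ∑ i : Fin 3, |dot3 ((∑ k ∈ S.filter (fun k => s k ≠ 1), m k) - f • ∑ k ∈ S, m k) (bPlus i) -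
        dot3 ((∑ k ∈ S.filter (fun k => s k ≠ 1), m k) - f • ∑ k ∈ S, m k) (bMinus i)| := by
  classical
  set n : Fin 3 → ℝ := ∑ k ∈ S, m k with hn
  set np : Fin 3 → ℝ := ∑ k ∈ S.filter (fun k => s k = 1), m k with hnp
  set nm : Fin 3 → ℝ := ∑ k ∈ S.filter (fun k => s k ≠ 1), m k with hnm
  set e : Fin 3 → ℝ := nm - f • n with he
  -- the calibrating flow
  obtain ⟨α, βp, βm, hα, hp, hm, hbal, heq⟩ := exists_stackTension_eq_calibFlux f hf0 hf1 n
  rw [heq]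
  unfold calibFlux
  -- decomposition of the normal into phases
  have hsplit : n = np + nm := by
    rw [hn, hnp, hnm]
    exact (Finset.sum_filter_add_sum_filter_not S (fun k => s k = 1) m).symm
  have hP : ∀ i, (1 - f) * dot3 n (bPlus i) = dot3 np (bPlus i) + dot3 e (bPlus i) := by
    intro i
    rw [he, dot3_sub_left, dot3_smul_left]
    conv_lhs => rw [hsplit]
    rw [dot3_add_left]
    rw [hsplit, dot3_add_left]
    ring
  have hM : ∀ i, f * dot3 n (bMinus i) = dot3 nm (bMinus i) - dot3 e (bMinus i) := by
    intro i
    rw [he, dot3_sub_left, dot3_smul_left]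
    ring
  -- (1) the in-plane part
  have h1 : ∑ i : Fin 3, α i * dot3 n (aVec i) ≤ ∑ i : Fin 3, |dot3 n (aVec i)| := by
    refine Finset.sum_le_sum fun i _ => ?_
    calc α i * dot3 n (aVec i) ≤ |α i * dot3 n (aVec i)| := le_abs_self _
      _ = |α i| * |dot3 n (aVec i)| := abs_mul _ _
      _ ≤ 1 * |dot3 n (aVec i)| := by gcongr; exact hα i
      _ = _ := one_mul _
  -- (2) the gap part, regrouped by layers
  have h2eq : (∑ i : Fin 3, βp i * dot3 np (bPlus i)) + (∑ i : Fin 3, βm i * dot3 nm (bMinus i)) =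
      ∑ k ∈ S, ∑ i : Fin 3, (if s k = 1 then βp i else βm i) *
        dot3 (m k) (if s k = 1 then bPlus i else bMinus i) := by
    rw [← Finset.sum_filter_add_sum_filter_not S (fun k => s k = 1)]
    congr 1
    · rw [hnp]
      simp only [dot3_sum_left, Finset.mul_sum]
      rw [Finset.sum_comm]
      refine Finset.sum_congr rfl fun k hk => Finset.sum_congr rfl fun i _ => ?_
      have hk1 : s k = 1 := (Finset.mem_filter.1 hk).2
      simp only [hk1, if_true]
    · rw [hnm]
      simp only [dot3_sum_left, Finset.mul_sum]
      rw [Finset.sum_comm]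
      refine Finset.sum_congr rfl fun k hk => Finset.sum_congr rfl fun i _ => ?_
      have hk1 : ¬ s k = 1 := (Finset.mem_filter.1 hk).2
      simp only [hk1, if_false]
  have hβsum : ∀ k, (∑ i : Fin 3, (if s k = 1 then βp i else βm i)) = ∑ i : Fin 3, βp i := by
    intro k
    by_cases hk : s k = 1
    · simp [hk]
    · simp only [hk, if_false]; exact hbal.symm
  have h2d : ∑ k ∈ S, ∑ i : Fin 3, (if s k = 1 then βp i else βm i) * d k = 0 := by
    have : ∀ k ∈ S, ∑ i : Fin 3, (if s k = 1 then βp i else βm i) * d k =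
        (∑ i : Fin 3, βp i) * d k := by
      intro k _
      rw [← Finset.sum_mul, hβsum k]
    rw [Finset.sum_congr rfl this, ← Finset.mul_sum, hd, mul_zero]
  have h2 : (∑ i : Fin 3, βp i * dot3 np (bPlus i)) + (∑ i : Fin 3, βm i * dot3 nm (bMinus i)) ≤
      ∑ k ∈ S, ∑ i : Fin 3, |dot3 (m k) (if s k = 1 then bPlus i else bMinus i) + d k| := by
    rw [h2eq]
    have hre : ∑ k ∈ S, ∑ i : Fin 3, (if s k = 1 then βp i else βm i) *
          dot3 (m k) (if s k = 1 then bPlus i else bMinus i) =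
        (∑ k ∈ S, ∑ i : Fin 3, (if s k = 1 then βp i else βm i) *
          (dot3 (m k) (if s k = 1 then bPlus i else bMinus i) + d k)) -
        ∑ k ∈ S, ∑ i : Fin 3, (if s k = 1 then βp i else βm i) * d k := by
      rw [← Finset.sum_sub_distrib]
      refine Finset.sum_congr rfl fun k _ => ?_
      rw [← Finset.sum_sub_distrib]
      refine Finset.sum_congr rfl fun i _ => ?_
      ring
    rw [hre, h2d, sub_zero]
    refine Finset.sum_le_sum fun k _ => Finset.sum_le_sum fun i _ => ?_
    have hβ : |(if s k = 1 then βp i else βm i)| ≤ 1 := by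
      split_ifs
      · exact hp i
      · exact hm i
    calc (if s k = 1 then βp i else βm i) * (dot3 (m k) (if s k = 1 then bPlus i else bMinus i) + d k)
        ≤ |(if s k = 1 then βp i else βm i) *
            (dot3 (m k) (if s k = 1 then bPlus i else bMinus i) + d k)| := le_abs_self _
      _ = |(if s k = 1 then βp i else βm i)| *
            |dot3 (m k) (if s k = 1 then bPlus i else bMinus i) + d k| := abs_mul _ _
      _ ≤ 1 * |dot3 (m k) (if s k = 1 then bPlus i else bMinus i) + d k| := by gcongr
      _ = _ := one_mul _
  -- (3) the skew part
  have h3 : (∑ i : Fin 3, βp i * dot3 e (bPlus i)) - (∑ i : Fin 3, βm i * dot3 e (bMinus i)) ≤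
      ∑ i : Fin 3, |dot3 e (bPlus i) - dot3 e (bMinus i)| := by
    have hc := dot3_bPlus_add_dot3_bMinus e
    have hc0 := hc 0; have hc1 := hc 1; have hc2 := hc 2
    simp only [Fin.sum_univ_three] at hbal ⊢
    have key : βp 0 * dot3 e (bPlus 0) + βp 1 * dot3 e (bPlus 1) + βp 2 * dot3 e (bPlus 2) -
        (βm 0 * dot3 e (bMinus 0) + βm 1 * dot3 e (bMinus 1) + βm 2 * dot3 e (bMinus 2)) =
        (βp 0 + βm 0) / 2 * (dot3 e (bPlus 0) - dot3 e (bMinus 0)) +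
        (βp 1 + βm 1) / 2 * (dot3 e (bPlus 1) - dot3 e (bMinus 1)) +
        (βp 2 + βm 2) / 2 * (dot3 e (bPlus 2) - dot3 e (bMinus 2)) := by
      have hv : (βp 0 - βm 0) / 2 * (dot3 e (bPlus 0) + dot3 e (bMinus 0)) +
          (βp 1 - βm 1) / 2 * (dot3 e (bPlus 1) + dot3 e (bMinus 1)) +
          (βp 2 - βm 2) / 2 * (dot3 e (bPlus 2) + dot3 e (bMinus 2)) = 0 := by
        rw [hc0, hc1, hc2]
        have : βp 0 - βm 0 + (βp 1 - βm 1) + (βp 2 - βm 2) = 0 := by linarith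
        calc _ = (βp 0 - βm 0 + (βp 1 - βm 1) + (βp 2 - βm 2)) / 2 * (2 * Real.sqrt (2 / 3) * e 2) := by
              ring
          _ = 0 := by rw [this]; ring
      linear_combination hv
    rw [key]
    have hb : ∀ i, (βp i + βm i) / 2 * (dot3 e (bPlus i) - dot3 e (bMinus i)) ≤
        |dot3 e (bPlus i) - dot3 e (bMinus i)| := by
      intro i
      have h1 : |(βp i + βm i) / 2| ≤ 1 := by
        rw [abs_div, abs_two]
        have := abs_add_le (βp i) (βm i)
        have := hp i; have := hm i
        rw [div_le_one (by norm_num : (0:ℝ) < 2)]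
        linarith
      calc (βp i + βm i) / 2 * (dot3 e (bPlus i) - dot3 e (bMinus i))
          ≤ |(βp i + βm i) / 2 * (dot3 e (bPlus i) - dot3 e (bMinus i))| := le_abs_self _
        _ = |(βp i + βm i) / 2| * |dot3 e (bPlus i) - dot3 e (bMinus i)| := abs_mul _ _
        _ ≤ 1 * |dot3 e (bPlus i) - dot3 e (bMinus i)| := by gcongr
        _ = _ := one_mul _
    linarith [hb 0, hb 1, hb 2]
  -- assemble
  have hmid : (1 - f) * (∑ i : Fin 3, βp i * dot3 n (bPlus i)) + f * (∑ i : Fin 3, βm i * dot3 n (bMinus i))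
      = ((∑ i : Fin 3, βp i * dot3 np (bPlus i)) + (∑ i : Fin 3, βm i * dot3 nm (bMinus i))) +
        ((∑ i : Fin 3, βp i * dot3 e (bPlus i)) - (∑ i : Fin 3, βm i * dot3 e (bMinus i))) := by
    rw [Finset.mul_sum, Finset.mul_sum]
    have eP : ∀ i, (1 - f) * (βp i * dot3 n (bPlus i)) = βp i * dot3 np (bPlus i) + βp i * dot3 e (bPlus i) := by
      intro i
      rw [← mul_add, ← hP i]; ring
    have eM : ∀ i, f * (βm i * dot3 n (bMinus i)) = βm i * dot3 nm (bMinus i) - βm i * dot3 e (bMinus i) := by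
      intro i
      rw [← mul_sub, ← hM i]; ring
    simp only [eP, eM, Finset.sum_add_distrib, Finset.sum_sub_distrib]
    ring
  linarith [h1, h2, h3, hmid.le, hmid.ge]

end Summit.Ventures.Crystal3D.Theorems

end
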